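import Summits.HubbardSuperconductivity.HubbardSuperconductivity.Theorems.BalabanIRBirGappedPhaseReductionTorusZeroModeRatio
import Summits.HubbardSuperconductivity.HubbardSuperconductivity.Theorems.BalabanIRBirBdGPhaseCoercivitySymbols
import HarnessLib

/-!
# Route BalabanIR — crux 4 `BirGappedPhaseReduction` / 4R (items `stmt-HubbardSuperconductivity-2082`, `…-14846`):
# the route's `d+id` torus reference — an explicitly EXTENSIVE zero-mode temporal stiffness

Instance of `…TorusZeroModeRatio` for the reference of crux 3 (`BirBdGPhaseCoercivity`): nearest-
neighbour hopping stencil `η = -𝟙[±e₁, ±e₂]`, chemical potential `μ`, and the `d+id` bond pairing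
stencil `Δv = Δ₁(𝟙[±e₁] - 𝟙[±e₂]) + iΔ₂(𝟙[±(e₁+e₂)] - 𝟙[±(e₁-e₂)])`, whose symbols are the band
function `ξ_k = -2cos p₀ - 2cos p₁ - μ` and the gap function `Δ̂_k = 2Δ₁(cos p₀ - cos p₁) - 4iΔ₂ sin p₀ sin p₁`
(`…Symbols.torusFourier_hopVec / _pairVec`, `L ≥ 3`).

* `dPlusId_eta_even`, `dPlusId_delta_even`, `dPlusId_symbol_real` — the hypotheses of the zero-mode
  theorems hold for this data;
* `dPlusId_dispersion_le` — `E_k ≤ E₁ := 4 + |μ| + 4|Δ₁| + 4|Δ₂|`; `dPlusId_gap_ge_on_good` — on the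
  GOOD momenta `L < 8k₀ ≤ 2L`, `L < 8k₁ ≤ 2L` (`p_i ∈ (π/4, π/2]`), `‖Δ̂_k‖ ≥ 2|Δ₂|`;
  `card_good_ge` — there are at least `(L/8)²` good momenta;
* **`dPlusId_norm_trace_prod_phase_le_aligned_mul_pow`** — for every even number `2n+2` of slices and
  every closed history `θ` of global pair phases,
  `‖W(θ)‖ ≤ ‖W(0)‖ · min(1, e^{-(κ₁/2)S(θ)} + 2e^{-(2n+2)·2|aΔ₂|})^{(L/8)²}`,
  `κ₁ = ¼ e^{-2|a|E₁} min(e^{-2|a|E₁}, 4a²Δ₂²)`, `S(θ) = Σ_t (1 - cos(θ_{t+1} - θ_t))`: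
  relative to the aligned history, a misaligned zero-mode pair-phase history of the route's gapped
  reference is suppressed by a factor EXPONENTIALLY SMALL IN THE VOLUME `L²` once the number of
  slices is large (`(2n+2)|aΔ₂| ≫ 1`) — the quantitative, extensive temporal half of hypothesis (C)
  of crux 2R for the reference weight in the zero spatial mode.

`Theses`-free, no definitions; `--supports` the crux. [folklore]
-/

noncomputable section

namespace Summit.HubbardSuperconductivity.HubbardSuperconductivity.Theorems

namespace BirBdG

open Matrix NormedSpace Literature.Probability.LatticeModels Literature.MathematicalPhysics.QuantumLattice
open scoped ComplexConjugate ComplexOrder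

section DPlusId

variable {L : ℕ} [NeZero L]

omit [NeZero L] in
/-- The hopping stencil is even. [folklore] -/
theorem dPlusId_eta_even (r : TorusSite 2 L) : -(if (((-r) = -![1, 0] ∨ (-r) = -![-1, 0]) ∨ ((-r) = -![0, 1] ∨ (-r) = -![0, -1])) then (1 : ℂ) else 0) = -(if ((r = -![1, 0] ∨ r = -![-1, 0]) ∨ (r = -![0, 1] ∨ r = -![0, -1])) then (1 : ℂ) else 0) := by
  simp only [neg_eq_iff_eq_neg, vec_neg10, vec_neg01, neg_neg]
  have h1 : (r = ![1, 0] ∨ r = -![1, 0]) ↔ (r = -![1, 0] ∨ r = ![1, 0]) := or_comm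
  have h2 : (r = ![0, 1] ∨ r = -![0, 1]) ↔ (r = -![0, 1] ∨ r = ![0, 1]) := or_comm
  simp only [h1, h2]

omit [NeZero L] in
/-- The `d+id` pairing stencil is even. [folklore] -/
theorem dPlusId_delta_even (Δ₁ Δ₂ : ℝ) (r : TorusSite 2 L) : ((Δ₁ : ℂ) * ((if ((-r) = -![1, 0] ∨ (-r) = -![-1, 0]) then (1 : ℂ) else 0) - (if ((-r) = -![0, 1] ∨ (-r) = -![0, -1]) then (1 : ℂ) else 0)) + Complex.I * (Δ₂ : ℂ) * ((if ((-r) = -![1, 1] ∨ (-r) = -![-1, -1]) then (1 : ℂ) else 0) - (if ((-r) = -![1, -1] ∨ (-r) = -![-1, 1]) then (1 : ℂ) else 0))) = ((Δ₁ : ℂ) * ((if (r = -![1, 0] ∨ r = -![-1, 0]) then (1 : ℂ) else 0) - (if (r = -![0, 1] ∨ r = -![0, -1]) then (1 : ℂ) else 0)) + Complex.I * (Δ₂ : ℂ) * ((if (r = -![1, 1] ∨ r = -![-1, -1]) then (1 : ℂ) else 0) - (if (r = -![1, -1] ∨ r = -![-1, 1]) then (1 : ℂ) else 0))) := by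
  simp only [neg_eq_iff_eq_neg, vec_neg10, vec_neg01, vec_neg11, vec_neg1m1, neg_neg]
  have h1 : (r = ![1, 0] ∨ r = -![1, 0]) ↔ (r = -![1, 0] ∨ r = ![1, 0]) := or_comm
  have h2 : (r = ![0, 1] ∨ r = -![0, 1]) ↔ (r = -![0, 1] ∨ r = ![0, 1]) := or_comm
  have h3 : (r = ![1, 1] ∨ r = -![1, 1]) ↔ (r = -![1, 1] ∨ r = ![1, 1]) := or_comm
  have h4 : (r = ![1, -1] ∨ r = -![1, -1]) ↔ (r = -![1, -1] ∨ r = ![1, -1]) := or_comm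
  simp only [h1, h2, h3, h4]

/-- The shifted hopping symbol is real. [folklore] -/
theorem dPlusId_symbol_real (hL : 3 ≤ L) (μ : ℝ) (k : TorusSite 2 L) : star (torusFourier (fun r => -(if ((r = -![1, 0] ∨ r = -![-1, 0]) ∨ (r = -![0, 1] ∨ r = -![0, -1])) then (1 : ℂ) else 0) - if r = 0 then (μ : ℂ) else 0) k) = torusFourier (fun r => -(if ((r = -![1, 0] ∨ r = -![-1, 0]) ∨ (r = -![0, 1] ∨ r = -![0, -1])) then (1 : ℂ) else 0) - if r = 0 then (μ : ℂ) else 0) k := by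
  rw [torusFourier_hopVec hL μ k, Complex.star_def, Complex.conj_ofReal]

/-- The band function: `Re ξ'_k = -2cos p₀ - 2cos p₁ - μ`, `|·| ≤ 4 + |μ|`. [folklore] -/
theorem dPlusId_symbol_re_abs_le (hL : 3 ≤ L) (μ : ℝ) (k : TorusSite 2 L) : |(torusFourier (fun r => -(if ((r = -![1, 0] ∨ r = -![-1, 0]) ∨ (r = -![0, 1] ∨ r = -![0, -1])) then (1 : ℂ) else 0) - if r = 0 then (μ : ℂ) else 0) k).re| ≤ 4 + |μ| := by
  rw [torusFourier_hopVec hL μ k, Complex.ofReal_re]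
  have h0 := Real.abs_cos_le_one (latticeMomentum L k 0)
  have h1 := Real.abs_cos_le_one (latticeMomentum L k 1)
  have hA := abs_sub (-2 * Real.cos (latticeMomentum L k 0) - 2 * Real.cos (latticeMomentum L k 1)) μ
  have hB := abs_sub (-2 * Real.cos (latticeMomentum L k 0)) (2 * Real.cos (latticeMomentum L k 1))
  rw [abs_mul, abs_mul, abs_neg, abs_two] at hB
  linarith

/-- The gap function is bounded: `‖Δ̂_k‖ ≤ 4|Δ₁| + 4|Δ₂|`. [folklore] -/
theorem dPlusId_gap_norm_le (hL : 3 ≤ L) (Δ₁ Δ₂ : ℝ) (k : TorusSite 2 L) : ‖torusFourier (fun r : TorusSite 2 L => ((Δ₁ : ℂ) * ((if (r = -![1, 0] ∨ r = -![-1, 0]) then (1 : ℂ) else 0) - (if (r = -![0, 1] ∨ r = -![0, -1]) then (1 : ℂ) else 0)) + Complex.I * (Δ₂ : ℂ) * ((if (r = -![1, 1] ∨ r = -![-1, -1]) then (1 : ℂ) else 0) - (if (r = -![1, -1] ∨ r = -![-1, 1]) then (1 : ℂ) else 0)))) k‖ ≤ 4 * |Δ₁| + 4 * |Δ₂| :=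 by
  rw [torusFourier_pairVec hL Δ₁ Δ₂ k]
  refine (norm_sub_le _ _).trans (add_le_add ?_ ?_)
  · rw [Complex.norm_real, Real.norm_eq_abs, abs_mul, abs_mul, abs_two]
    have h0 := Real.abs_cos_le_one (latticeMomentum L k 0)
    have h1 := Real.abs_cos_le_one (latticeMomentum L k 1)
    have h := abs_sub (Real.cos (latticeMomentum L k 0)) (Real.cos (latticeMomentum L k 1))
    nlinarith [abs_nonneg Δ₁]
  · rw [norm_mul, norm_mul, Complex.norm_I, Complex.norm_real, Real.norm_eq_abs, abs_mul, abs_mul]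
    have h0 := Real.abs_sin_le_one (latticeMomentum L k 0)
    have h1 := Real.abs_sin_le_one (latticeMomentum L k 1)
    have hss : |Real.sin (latticeMomentum L k 0)| * |Real.sin (latticeMomentum L k 1)| ≤ 1 := by
      calc |Real.sin (latticeMomentum L k 0)| * |Real.sin (latticeMomentum L k 1)| ≤ 1 * 1 :=
            mul_le_mul h0 h1 (abs_nonneg _) zero_le_one
        _ = 1 := one_mul 1
    have : |Δ₂| * |Real.sin (latticeMomentum L k 0)| * |Real.sin (latticeMomentum L k 1)| ≤ |Δ₂| := by
      rw [mul_assoc]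
      exact (mul_le_mul_of_nonneg_left hss (abs_nonneg Δ₂)).trans_eq (mul_one _)
    norm_num
    linarith

/-- The dispersion is bounded: `E_k ≤ E₁ = 4 + |μ| + 4|Δ₁| + 4|Δ₂|`. [folklore] -/
theorem dPlusId_dispersion_le (hL : 3 ≤ L) (μ Δ₁ Δ₂ : ℝ) (k : TorusSite 2 L) : Real.sqrt ((torusFourier (fun r => -(if ((r = -![1, 0] ∨ r = -![-1, 0]) ∨ (r = -![0, 1] ∨ r = -![0, -1])) then (1 : ℂ) else 0) - if r = 0 then (μ : ℂ) else 0) k).re ^ 2 + ‖torusFourier (fun r : TorusSite 2 L => ((Δ₁ : ℂ) * ((if (r = -![1, 0] ∨ r = -![-1, 0]) then (1 : ℂ) else 0) - (if (r = -![0, 1] ∨ r = -![0, -1]) then (1 : ℂ) else 0)) + Complex.I * (Δ₂ : ℂ) * ((if (r = -![1, 1] ∨ r = -![-1, -1]) then (1 : ℂ) else 0) - (if (r = -![1, -1] ∨ r = -![-1, 1]) then (1 : ℂ) else 0)))) k‖ ^ 2) ≤ (4 + |μ| + 4 * |Δ₁| + 4 * |Δ₂|) := by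
  have h1 := dPlusId_symbol_re_abs_le hL μ k
  have h2 := dPlusId_gap_norm_le hL Δ₁ Δ₂ k
  have hsum : Real.sqrt ((torusFourier (fun r => -(if ((r = -![1, 0] ∨ r = -![-1, 0]) ∨ (r = -![0, 1] ∨ r = -![0, -1])) then (1 : ℂ) else 0) - if r = 0 then (μ : ℂ) else 0) k).re ^ 2 + ‖torusFourier (fun r : TorusSite 2 L => ((Δ₁ : ℂ) * ((if (r = -![1, 0] ∨ r = -![-1, 0]) then (1 : ℂ) else 0) - (if (r = -![0, 1] ∨ r = -![0, -1]) then (1 : ℂ) else 0)) + Complex.I * (Δ₂ : ℂ) * ((if (r = -![1, 1] ∨ r = -![-1, -1]) then (1 : ℂ) else 0) - (if (r = -![1, -1] ∨ r = -![-1, 1]) then (1 : ℂ) else 0)))) k‖ ^ 2) ≤ |(torusFourier (fun r => -(if ((r = -![1, 0] ∨ r = -![-1, 0]) ∨ (r = -![0, 1] ∨ r = -![0, -1])) then (1 : ℂ) else 0) - if r = 0 then (μ : ℂ) else 0) k).re| + ‖torusFourier (fun r : TorusSite 2 L => ((Δ₁ : ℂ) * ((if (r = -![1, 0] ∨ r =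 -![-1, 0]) then (1 : ℂ) else 0) - (if (r = -![0, 1] ∨ r = -![0, -1]) then (1 : ℂ) else 0)) + Complex.I * (Δ₂ : ℂ) * ((if (r = -![1, 1] ∨ r = -![-1, -1]) then (1 : ℂ) else 0) - (if (r = -![1, -1] ∨ r = -![-1, 1]) then (1 : ℂ) else 0)))) k‖ := by
    rw [Real.sqrt_le_left (by positivity)]
    nlinarith [abs_nonneg ((torusFourier (fun r => -(if ((r = -![1, 0] ∨ r = -![-1, 0]) ∨ (r = -![0, 1] ∨ r = -![0, -1])) then (1 : ℂ) else 0) - if r = 0 then (μ : ℂ) else 0) k).re), norm_nonneg (torusFourier (fun r : TorusSite 2 L => ((Δ₁ : ℂ) * ((if (r = -![1, 0] ∨ r = -![-1, 0]) then (1 : ℂ) else 0) - (if (r = -![0, 1] ∨ r = -![0, -1]) then (1 : ℂ) else 0)) + Complex.I * (Δ₂ : ℂ) * ((if (r = -![1, 1] ∨ r = -![-1, -1]) then (1 : ℂ) else 0) - (if (r = -![1, -1] ∨ r = -![-1, 1]) then (1 : ℂ) else 0)))) k), sq_abs ((torusFourier (fun r => -(if ((r = -![1, 0] ∨ r = -![-1,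 0]) ∨ (r = -![0, 1] ∨ r = -![0, -1])) then (1 : ℂ) else 0) - if r = 0 then (μ : ℂ) else 0) k).re)]
  linarith

/-- On the good momenta (`L < 8kᵢ ≤ 2L`, i.e. `pᵢ ∈ (π/4, π/2]`): `√2/2 ≤ sin pᵢ`. [folklore] -/
theorem sin_latticeMomentum_ge_of_good {k : TorusSite 2 L} {i : Fin 2} (h1 : L < 8 * (k i).val)
    (h2 : 8 * (k i).val ≤ 2 * L) : Real.sqrt 2 / 2 ≤ Real.sin (latticeMomentum L k i) := by
  have hL : (0 : ℝ) < L := Nat.cast_pos.mpr (NeZero.pos L)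
  have h1' : (L : ℝ) < 8 * ((k i).val : ℝ) := by exact_mod_cast h1
  have h2' : 8 * ((k i).val : ℝ) ≤ 2 * (L : ℝ) := by exact_mod_cast h2
  have hp1 : Real.pi / 4 ≤ latticeMomentum L k i := by
    unfold latticeMomentum
    rw [le_div_iff₀ hL]
    nlinarith [Real.pi_pos]
  have hp2 : latticeMomentum L k i ≤ Real.pi / 2 := by
    unfold latticeMomentum
    rw [div_le_iff₀ hL]
    nlinarith [Real.pi_pos]
  rw [← Real.sin_pi_div_four]
  exact Real.sin_le_sin_of_le_of_le_pi_div_two (by linarith [Real.pi_pos]) hp2 hp1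

/-- On the good momenta the gap function is at least `2|Δ₂|`: `‖Δ̂_k‖ ≥ |Im Δ̂_k| = 4|Δ₂| sin p₀ sin p₁`.
[folklore] -/
theorem dPlusId_gap_ge_on_good (hL : 3 ≤ L) (Δ₁ Δ₂ : ℝ) {k : TorusSite 2 L}
    (hk : ∀ i : Fin 2, L < 8 * (k i).val ∧ 8 * (k i).val ≤ 2 * L) : 2 * |Δ₂| ≤ ‖torusFourier (fun r : TorusSite 2 L => ((Δ₁ : ℂ) * ((if (r = -![1, 0] ∨ r = -![-1, 0]) then (1 : ℂ) else 0) - (if (r = -![0, 1] ∨ r = -![0, -1]) then (1 : ℂ) else 0)) + Complex.I * (Δ₂ : ℂ) * ((if (r = -![1, 1] ∨ r = -![-1, -1]) then (1 : ℂ) else 0) - (if (r = -![1, -1] ∨ r = -![-1, 1]) then (1 : ℂ) else 0)))) k‖ := by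
  have hs0 := sin_latticeMomentum_ge_of_good (hk 0).1 (hk 0).2
  have hs1 := sin_latticeMomentum_ge_of_good (hk 1).1 (hk 1).2
  have hsq : Real.sqrt 2 / 2 * (Real.sqrt 2 / 2) = 1 / 2 := by
    rw [div_mul_div_comm, Real.mul_self_sqrt (by norm_num)]; norm_num
  have h22 : (0 : ℝ) < Real.sqrt 2 / 2 := by positivity
  have hprod : 1 / 2 ≤ Real.sin (latticeMomentum L k 0) * Real.sin (latticeMomentum L k 1) := by
    rw [← hsq]; exact mul_le_mul hs0 hs1 h22.le (h22.le.trans hs0)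
  refine le_trans ?_ (Complex.abs_im_le_norm _)
  rw [torusFourier_pairVec hL Δ₁ Δ₂ k]
  simp only [Complex.sub_im, Complex.ofReal_im, Complex.mul_im, Complex.re_ofNat, Complex.I_re,
    Complex.im_ofNat, Complex.I_im, Complex.ofReal_re, Complex.mul_re, zero_sub, mul_zero, sub_zero,
    add_zero, mul_one, zero_add]
  rw [abs_neg, abs_mul, abs_mul, abs_mul, abs_of_pos (by norm_num : (0:ℝ) < 4),
    abs_of_nonneg (h22.le.trans hs0), abs_of_nonneg (h22.le.trans hs1)]
  nlinarith [abs_nonneg Δ₂, mul_le_mul_of_nonneg_left hprod (abs_nonneg Δ₂)]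

omit [NeZero L] in
/-- There are at least `(L/8)²` good momenta. [folklore] -/
theorem card_good_ge [NeZero L] : (L / 8) ^ 2 ≤ ((Finset.univ.filter fun k : TorusSite 2 L => ∀ i : Fin 2, L < 8 * (k i).val ∧ 8 * (k i).val ≤ 2 * L)).card := by
  classical
  set m : ℕ := L / 8 with hm
  have hmL : 8 * m ≤ L := Nat.mul_div_le L 8
  have hLm : L < 8 * m + 8 := by
    have := Nat.div_add_mod L 8
    have := Nat.mod_lt L (by norm_num : 0 < 8)
    omega
  -- the injection `(i, j) ↦ (m+1+i, m+1+j)`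
  let f : Fin m × Fin m → TorusSite 2 L := fun ij => ![((m + 1 + ij.1 : ℕ) : ZMod L), ((m + 1 + ij.2 : ℕ) : ZMod L)]
  have hval : ∀ (i : Fin m), ((m + 1 + i : ℕ) : ZMod L).val = m + 1 + i := fun i =>
    ZMod.val_natCast_of_lt (by omega)
  have hgood : ∀ ij, f ij ∈ (Finset.univ.filter fun k : TorusSite 2 L => ∀ i : Fin 2, L < 8 * (k i).val ∧ 8 * (k i).val ≤ 2 * L) := by
    rintro ⟨i, j⟩
    simp only [Finset.mem_filter, Finset.mem_univ, true_and, f]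
    intro t
    fin_cases t
    · simp only [Fin.zero_eta, Fin.isValue, Matrix.cons_val_zero, hval]
      omega
    · simp only [Fin.mk_one, Fin.isValue, Matrix.cons_val_one, Matrix.cons_val_fin_one, hval]
      omega
  have hinj : Function.Injective f := by
    rintro ⟨i, j⟩ ⟨i', j'⟩ h
    have h0 := congrArg (fun v : TorusSite 2 L => (v 0).val) h
    have h1 := congrArg (fun v : TorusSite 2 L => (v 1).val) h
    simp only [f, Matrix.cons_val_zero, Matrix.cons_val_one, Matrix.cons_val_fin_one, hval] at h0 h1
    ext <;> simp only <;> omega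
  calc (L / 8) ^ 2 = (Finset.univ : Finset (Fin m × Fin m)).card := by simp [hm, sq]
    _ = ((Finset.univ : Finset (Fin m × Fin m)).image f).card := (Finset.card_image_of_injective _ hinj).symm
    _ ≤ ((Finset.univ.filter fun k : TorusSite 2 L => ∀ i : Fin 2, L < 8 * (k i).val ∧ 8 * (k i).val ≤ 2 * L)).card := Finset.card_le_card (fun x hx => by
        obtain ⟨ij, _, rfl⟩ := Finset.mem_image.mp hx
        exact hgood ij)

/-- **Extensive zero-mode temporal coercivity of the route's `d+id` torus reference.** For `L ≥ 3`,
any relabelling `e : Λ ≃ (ℤ/L)²` of the Jordan–Wigner sites, the nearest-neighbour hopping with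
chemical potential `μ`, the `d+id` bond pairing (`Δ₁`, `Δ₂`), a step `a`, an even number `2n+2` of
slices and a closed history `θ` of global pair phases:
`‖W(θ)‖ ≤ ‖W(0)‖ · min(1, e^{-(κ₁/2)S(θ)} + 2e^{-(2n+2)·2|aΔ₂|})^{(L/8)²}`,
`κ₁ = ¼ e^{-2|a|E₁} min(e^{-2|a|E₁}, 4a²Δ₂²)`, `E₁ = 4 + |μ| + 4|Δ₁| + 4|Δ₂|`,
`S(θ) = Σ_t (1 - cos(θ_{t+1} - θ_t))` — a suppression exponentially small in the VOLUME once the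
number of slices is large. [folklore] -/
theorem dPlusId_norm_trace_prod_phase_le_aligned_mul_pow (hL : 3 ≤ L) {Λ : Type*} [LinearOrder Λ]
    [Fintype Λ] (e : Λ ≃ TorusSite 2 L) (μ Δ₁ Δ₂ a : ℝ) {n : ℕ} (θ : Fin (2 * n + 2) → ℝ) :
    ‖((List.ofFn fun t => Matrix.gibbsWeight a (bdgBondHamiltonian (fun u v => -(if (((e u - e v) = -![1, 0] ∨ (e u - e v) = -![-1, 0]) ∨ ((e u - e v) = -![0, 1] ∨ (e u - e v) = -![0, -1])) then (1 : ℂ) else 0)) (fun u v => Complex.exp (Complex.I * θ t) * (-(1 / 2 : ℂ) * star ((Δ₁ : ℂ) * ((if ((e u - e v) = -![1, 0] ∨ (e u - e v) = -![-1, 0]) then (1 : ℂ) else 0) - (if ((e u - e v) = -![0, 1] ∨ (e u - e v) = -![0, -1]) then (1 : ℂ) else 0)) + Complex.I * (Δ₂ : ℂ) * ((if ((e u - e v) = -![1, 1] ∨ (e u - e v) = -![-1, -1]) then (1 : ℂ) else 0) - (if ((e u - e v) = -![1, -1] ∨ (e u - e v) = -![-1, 1]) then (1 : ℂ) else 0)))))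 μ)).prod).trace‖ ≤
      ‖((List.ofFn fun _ : Fin (2 * n + 2) => Matrix.gibbsWeight a (bdgBondHamiltonian (fun u v => -(if (((e u - e v) = -![1, 0] ∨ (e u - e v) = -![-1, 0]) ∨ ((e u - e v) = -![0, 1] ∨ (e u - e v) = -![0, -1])) then (1 : ℂ) else 0)) (fun u v => Complex.exp (Complex.I * (0 : ℝ)) * (-(1 / 2 : ℂ) * star ((Δ₁ : ℂ) * ((if ((e u - e v) = -![1, 0] ∨ (e u - e v) = -![-1, 0]) then (1 : ℂ) else 0) - (if ((e u - e v) = -![0, 1] ∨ (e u - e v) = -![0, -1]) then (1 : ℂ) else 0)) + Complex.I * (Δ₂ : ℂ) * ((if ((e u - e v) = -![1, 1] ∨ (e u - e v) = -![-1, -1]) then (1 : ℂ) else 0) - (if ((e u - e v) = -![1, -1] ∨ (e u - e v) = -![-1, 1]) then (1 : ℂ) else 0))))) μ)).prod).trace‖ *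
        (min 1 (Real.exp (-(Real.exp (-(2 * |a| * (4 + |μ| + 4 * |Δ₁| + 4 * |Δ₂|))) * min (Real.exp (-(2 * |a| * (4 + |μ| + 4 * |Δ₁| + 4 * |Δ₂|)))) (a ^ 2 * (2 * |Δ₂|) ^ 2) / 4 / 2 * ∑ t : Fin (2 * n + 2), (1 - Real.cos (θ (t + 1) - θ t)))) + 2 * Real.exp (-((2 * n + 2) * |a| * (2 * |Δ₂|))))) ^ ((L / 8) ^ 2) := by
  have hη : ∀ r : TorusSite 2 L, (fun r : TorusSite 2 L => -(if ((r = -![1, 0] ∨ r = -![-1, 0]) ∨ (r = -![0, 1] ∨ r = -![0, -1])) then (1 : ℂ) else 0)) (-r) = (fun r : TorusSite 2 L => -(if ((r = -![1, 0] ∨ r = -![-1, 0]) ∨ (r = -![0, 1] ∨ r = -![0, -1])) then (1 : ℂ) else 0)) r := fun r => dPlusId_eta_even r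
  have hΔ : ∀ r : TorusSite 2 L, (fun r : TorusSite 2 L => ((Δ₁ : ℂ) * ((if (r = -![1, 0] ∨ r = -![-1, 0]) then (1 : ℂ) else 0) - (if (r = -![0, 1] ∨ r = -![0, -1]) then (1 : ℂ) else 0)) + Complex.I * (Δ₂ : ℂ) * ((if (r = -![1, 1] ∨ r = -![-1, -1]) then (1 : ℂ) else 0) - (if (r = -![1, -1] ∨ r = -![-1, 1]) then (1 : ℂ) else 0)))) (-r) = (fun r : TorusSite 2 L => ((Δ₁ : ℂ) * ((if (r = -![1, 0] ∨ r = -![-1, 0]) then (1 : ℂ) else 0) - (if (r = -![0, 1] ∨ r = -![0, -1]) then (1 : ℂ) else 0)) + Complex.I * (Δ₂ : ℂ) * ((if (r = -![1, 1] ∨ r = -![-1, -1]) then (1 : ℂ) else 0) - (if (r = -![1, -1] ∨ r = -![-1, 1]) then (1 : ℂ) else 0)))) r := fun r => dPlusId_delta_even Δ₁ Δ₂ r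
  have hreal := dPlusId_symbol_real hL μ (L := L)
  -- the bound on the good set and on the empty set
  have hκG : ∀ k ∈ (Finset.univ.filter fun k : TorusSite 2 L => ∀ i : Fin 2, L < 8 * (k i).val ∧ 8 * (k i).val ≤ 2 * L), Real.exp (-(2 * |a| * (4 + |μ| + 4 * |Δ₁| + 4 * |Δ₂|))) * min (Real.exp (-(2 * |a| * (4 + |μ| + 4 * |Δ₁| + 4 * |Δ₂|)))) (a ^ 2 * (2 * |Δ₂|) ^ 2) / 4 ≤
      Real.exp (-(2 * |a| * Real.sqrt ((torusFourier (fun r => -(if ((r = -![1, 0] ∨ r = -![-1, 0]) ∨ (r = -![0, 1] ∨ r = -![0, -1])) then (1 : ℂ) else 0) - if r = 0 then (μ : ℂ) else 0) k).re ^ 2 + ‖torusFourier (fun r : TorusSite 2 L => ((Δ₁ : ℂ) * ((if (r = -![1, 0] ∨ r = -![-1, 0]) then (1 : ℂ) else 0) - (if (r = -![0, 1] ∨ r = -![0, -1]) then (1 : ℂ) else 0)) + Complex.I * (Δ₂ : ℂ) * ((if (r = -![1, 1] ∨ r = -![-1, -1]) then (1 : ℂ) else 0) - (if (r = -![1, -1]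 ∨ r = -![-1, 1]) then (1 : ℂ) else 0)))) k‖ ^ 2))) * min (Real.exp (-(2 * |a| * Real.sqrt ((torusFourier (fun r => -(if ((r = -![1, 0] ∨ r = -![-1, 0]) ∨ (r = -![0, 1] ∨ r = -![0, -1])) then (1 : ℂ) else 0) - if r = 0 then (μ : ℂ) else 0) k).re ^ 2 + ‖torusFourier (fun r : TorusSite 2 L => ((Δ₁ : ℂ) * ((if (r = -![1, 0] ∨ r = -![-1, 0]) then (1 : ℂ) else 0) - (if (r = -![0, 1] ∨ r = -![0, -1]) then (1 : ℂ) else 0)) + Complex.I * (Δ₂ : ℂ) * ((if (r = -![1, 1] ∨ r = -![-1, -1]) then (1 : ℂ) else 0) - (if (r = -![1, -1] ∨ r = -![-1, 1]) then (1 : ℂ) else 0)))) k‖ ^ 2)))) (a ^ 2 * ‖torusFourier (fun r : TorusSite 2 L => ((Δ₁ : ℂ) * ((if (r = -![1, 0] ∨ r = -![-1, 0]) then (1 : ℂ) else 0) - (if (r = -![0, 1] ∨ r = -![0, -1]) then (1 : ℂ) else 0)) + Complex.I * (Δ₂ : ℂ) * ((if (r = -![1, 1] ∨ r = -![-1, -1])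 then (1 : ℂ) else 0) - (if (r = -![1, -1] ∨ r = -![-1, 1]) then (1 : ℂ) else 0)))) k‖ ^ 2) / 4 := by
    intro k hk
    have hk' := (Finset.mem_filter.mp hk).2
    have hE := dPlusId_dispersion_le hL μ Δ₁ Δ₂ k
    have hg := dPlusId_gap_ge_on_good hL Δ₁ Δ₂ hk'
    have h2 : 0 ≤ 2 * |Δ₂| := by positivity
    gcongr
  have hEk : ∀ k ∈ (Finset.univ.filter fun k : TorusSite 2 L => ∀ i : Fin 2, L < 8 * (k i).val ∧ 8 * (k i).val ≤ 2 * L), 2 * |Δ₂| ≤ Real.sqrt ((torusFourier (fun r => -(if ((r = -![1, 0] ∨ r = -![-1, 0]) ∨ (r = -![0, 1] ∨ r = -![0, -1])) then (1 : ℂ) else 0) - if r = 0 then (μ : ℂ) else 0) k).re ^ 2 + ‖torusFourier (fun r : TorusSite 2 L => ((Δ₁ : ℂ) * ((if (r = -![1, 0] ∨ r = -![-1, 0]) then (1 : ℂ) else 0) - (if (r = -![0, 1] ∨ r = -![0, -1]) then (1 : ℂ) else 0)) + Complex.I * (Δ₂ : ℂ) * ((if (r = -![1, 1] ∨ r = -![-1,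 -1]) then (1 : ℂ) else 0) - (if (r = -![1, -1] ∨ r = -![-1, 1]) then (1 : ℂ) else 0)))) k‖ ^ 2) := by
    intro k hk
    have hk' := (Finset.mem_filter.mp hk).2
    have hg := dPlusId_gap_ge_on_good hL Δ₁ Δ₂ hk'
    refine hg.trans ?_
    have h := Real.abs_le_sqrt (show ‖torusFourier (fun r : TorusSite 2 L => ((Δ₁ : ℂ) * ((if (r = -![1, 0] ∨ r = -![-1, 0]) then (1 : ℂ) else 0) - (if (r = -![0, 1] ∨ r = -![0, -1]) then (1 : ℂ) else 0)) + Complex.I * (Δ₂ : ℂ) * ((if (r = -![1, 1] ∨ r = -![-1, -1]) then (1 : ℂ) else 0) - (if (r = -![1, -1] ∨ r = -![-1, 1]) then (1 : ℂ) else 0)))) k‖ ^ 2 ≤ (torusFourier (fun r => -(if ((r = -![1, 0] ∨ r = -![-1, 0]) ∨ (r = -![0, 1] ∨ r = -![0, -1])) then (1 : ℂ) else 0) - if r = 0 then (μ : ℂ) else 0) k).re ^ 2 + ‖torusFourier (fun r : TorusSite 2 L => ((Δ₁ : ℂ) * ((if (r = -![1, 0] ∨ r = -![-1, 0]) then (1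 : ℂ) else 0) - (if (r = -![0, 1] ∨ r = -![0, -1]) then (1 : ℂ) else 0)) + Complex.I * (Δ₂ : ℂ) * ((if (r = -![1, 1] ∨ r = -![-1, -1]) then (1 : ℂ) else 0) - (if (r = -![1, -1] ∨ r = -![-1, 1]) then (1 : ℂ) else 0)))) k‖ ^ 2 by nlinarith)
    rwa [abs_of_nonneg (norm_nonneg _)] at h
  have hP := norm_trace_prod_gibbsWeight_bdgTorus_phase_le_aligned_mul_pow e (fun r : TorusSite 2 L => -(if ((r = -![1, 0] ∨ r = -![-1, 0]) ∨ (r = -![0, 1] ∨ r = -![0, -1])) then (1 : ℂ) else 0)) (fun r : TorusSite 2 L => ((Δ₁ : ℂ) * ((if (r = -![1, 0] ∨ r = -![-1, 0]) then (1 : ℂ) else 0) - (if (r = -![0, 1] ∨ r = -![0, -1]) then (1 : ℂ) else 0)) + Complex.I * (Δ₂ : ℂ) * ((if (r = -![1, 1] ∨ r = -![-1, -1]) then (1 : ℂ) else 0) - (if (r = -![1, -1] ∨ r = -![-1, 1]) then (1 : ℂ) else 0)))) hη hΔ μ a hreal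
    (Finset.univ.filter fun k : TorusSite 2 L => ∀ i : Fin 2, L < 8 * (k i).val ∧ 8 * (k i).val ≤ 2 * L) (Real.exp (-(2 * |a| * (4 + |μ| + 4 * |Δ₁| + 4 * |Δ₂|))) * min (Real.exp (-(2 * |a| * (4 + |μ| + 4 * |Δ₁| + 4 * |Δ₂|)))) (a ^ 2 * (2 * |Δ₂|) ^ 2) / 4) (2 * |Δ₂|) hκG hEk θ
  have hP0 := norm_trace_prod_gibbsWeight_bdgTorus_phase_le_aligned_mul_pow e (fun r : TorusSite 2 L => -(if ((r = -![1, 0] ∨ r = -![-1, 0]) ∨ (r = -![0, 1] ∨ r = -![0, -1])) then (1 : ℂ) else 0)) (fun r : TorusSite 2 L => ((Δ₁ : ℂ) * ((if (r = -![1, 0] ∨ r = -![-1, 0]) then (1 : ℂ) else 0) - (if (r = -![0, 1] ∨ r = -![0, -1]) then (1 : ℂ) else 0)) + Complex.I * (Δ₂ : ℂ) * ((if (r = -![1, 1] ∨ r = -![-1, -1]) then (1 : ℂ) else 0) - (if (r = -![1, -1] ∨ r = -![-1, 1]) then (1 : ℂ) else 0)))) hη hΔ μ a hreal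
    ∅ (Real.exp (-(2 * |a| * (4 + |μ| + 4 * |Δ₁| + 4 * |Δ₂|))) * min (Real.exp (-(2 * |a| * (4 + |μ| + 4 * |Δ₁| + 4 * |Δ₂|)))) (a ^ 2 * (2 * |Δ₂|) ^ 2) / 4) (2 * |Δ₂|) (fun k hk => absurd hk (Finset.notMem_empty k)) (fun k hk => absurd hk (Finset.notMem_empty k)) θ
  rw [Finset.card_empty, pow_zero, mul_one] at hP0
  have ht0 : 0 ≤ (Real.exp (-(Real.exp (-(2 * |a| * (4 + |μ| + 4 * |Δ₁| + 4 * |Δ₂|))) * min (Real.exp (-(2 * |a| * (4 + |μ| + 4 * |Δ₁| + 4 * |Δ₂|)))) (a ^ 2 * (2 * |Δ₂|) ^ 2) / 4 / 2 * ∑ t : Fin (2 * n + 2), (1 - Real.cos (θ (t + 1) - θ t)))) + 2 * Real.exp (-((2 * n + 2) * |a| * (2 * |Δ₂|)))) := by positivity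
  by_cases ht : (Real.exp (-(Real.exp (-(2 * |a| * (4 + |μ| + 4 * |Δ₁| + 4 * |Δ₂|))) * min (Real.exp (-(2 * |a| * (4 + |μ| + 4 * |Δ₁| + 4 * |Δ₂|)))) (a ^ 2 * (2 * |Δ₂|) ^ 2) / 4 / 2 * ∑ t : Fin (2 * n + 2), (1 - Real.cos (θ (t + 1) - θ t)))) + 2 * Real.exp (-((2 * n + 2) * |a| * (2 * |Δ₂|)))) ≤ 1
  · rw [min_eq_right ht]
    refine hP.trans (mul_le_mul_of_nonneg_left ?_ (norm_nonneg _))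
    exact pow_le_pow_of_le_one ht0 ht card_good_ge
  · rw [min_eq_left (le_of_not_ge ht), one_pow, mul_one]
    exact hP0

end DPlusId


end BirBdG

end Summit.HubbardSuperconductivity.HubbardSuperconductivity.Theorems
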